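import Literature.NumberTheory.Transcendental.CurvePeriodsGmBakerProofs
import Literature.NumberTheory.Transcendental.CurvePeriodsPuncturedLineProofs
import Literature.NumberTheory.Transcendental.CurvePeriodsStokesProofs
import Literature.NumberTheory.Transcendental.CurvePeriodsAffineLineProofs

/-!
# KontsevichZagierPeriods — kz1p (R1)–(R5) derivations, part 1: the principal logarithm along a segment

Cell pub-kz1p, seat b2b-kz1p-2, gen 12 (kz1p v1.3; PROCEDURE.md §4d; LEAN-IN-TREE rule).  Pure mathematics over
the tree's formal period space `Literature.NumberTheory.Transcendental.CurvePeriods` ([cite: HuberWustholz2022,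
§13.1 (p. 120), Thm. 13.3 (2)]); no named facts, no `sorry`.

* `exists_log_segment` — a `C¹` logarithm of the segment `[p, q]`, `q = w p`, `w ∉ (−∞, 0]`, with increment `Log w`;
* `span_segment_logSym` — hence the symbol `(𝔾ₘ, y dx, segment)` equals `ℓ(Log w)` modulo elementary relations
  ((R4) base change of the standard path, [cite: HuberWustholz2022, §13.1 (B)]).

See `KzOnePeriodsG0Derivation.lean` (part 5) for the overview of the whole interface.
-/

noncomputable section

open scoped BigOperators Real
open MvPolynomial Set Complex
open Literature.NumberTheory.Transcendental
open Literature.NumberTheory.Transcendental.CurvePeriods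

namespace Summit.KontsevichZagierPeriods.KzOnePeriods.G0Derivation

local notation3 "InSpanRel " c:arg => ∃ (k : ℕ) (ρ : Fin k → (PeriodSymbol →₀ ℂ))
  (a : Fin k → ℂ), (∀ l, IsElementaryRelation (ρ l)) ∧ (∀ l, IsAlgebraic ℚ (a l)) ∧
    c = ∑ l, a l • ρ l

local notation3 (prettyPrint := false) "𝔾m" => (⟨2, 1, ![X 0 * X 1 - 1]⟩ : CurveData)

local notation3 "logSym " E:arg => (⟨⟨2, 1, ![X 0 * X 1 - 1]⟩, isSmoothAffineCurve_mulGroup,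
  ![X 1, 0], hasAlgCoeffs_ydx, E⟩ : PeriodSymbol)

/-! ### The principal logarithm along a segment in `ℂ*` -/

/-- The segment from `1` to `w ∈ ℂ ∖ (−∞, 0]` stays in the slit plane. [folklore] -/
theorem one_add_mul_mem_slitPlane {w : ℂ} (hw : w ∈ slitPlane) {t : ℝ} (ht : t ∈ Icc (0 : ℝ) 1) :
    1 + (t : ℂ) * (w - 1) ∈ slitPlane := by
  have h := starConvex_one_slitPlane hw (sub_nonneg.2 ht.2) ht.1 (sub_add_cancel 1 t)
  have e : (1 - t) • (1 : ℂ) + t • w = 1 + (t : ℂ) * (w - 1) := by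
    simp only [Complex.real_smul]
    push_cast
    ring
  rwa [e] at h

/-- **Logarithm along a segment.** For `p ≠ 0` and `q = w p` with `w ∉ (−∞, 0]` (equivalently:
`0 ∉ [p, q]`) there is a `C¹` logarithm `L` of the segment `t ↦ p + t (q − p)` on `[0, 1]` whose
increment is the principal value `L(1) − L(0) = Log w`. [folklore] -/
theorem exists_log_segment {p q w : ℂ} (hp : p ≠ 0) (hw : w * p = q) (hslit : w ∈ slitPlane) :
    ∃ L : ℝ → ℂ, ContDiff ℝ 1 L ∧ (∀ t ∈ Icc (0 : ℝ) 1, exp (L t) = p + t * (q - p)) ∧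
      exp (L 0) = p ∧ L 1 - L 0 = log w := by
  -- the segment and its derivative
  set x : ℝ → ℂ := fun t => p + (t : ℂ) * (q - p) with hx_def
  have hxd : ∀ t : ℝ, HasDerivAt x (q - p) t := by
    intro t
    have h := ((hasDerivAt_id (t : ℂ)).mul_const (q - p)).const_add p
    simpa [x] using h.comp_ofReal
  have hxC : ContDiffOn ℝ 1 x (Icc 0 1) :=
    ((contDiff_const.add (ofRealCLM.contDiff.mul contDiff_const)).contDiffOn : ContDiffOn ℝ 1 x _)
  have hxw : ∀ t : ℝ, x t = p * (1 + (t : ℂ) * (w - 1)) := by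
    intro t; simp only [x]; rw [← hw]; ring
  have hslit_t : ∀ t ∈ Icc (0 : ℝ) 1, 1 + (t : ℂ) * (w - 1) ∈ slitPlane :=
    fun t ht => one_add_mul_mem_slitPlane hslit ht
  have hx0 : ∀ t ∈ Icc (0 : ℝ) 1, x t ≠ 0 := fun t ht => by
    rw [hxw]; exact mul_ne_zero hp (slitPlane_ne_zero (hslit_t t ht))
  obtain ⟨L, hLC, hL0, hLd, hLexp⟩ := exists_contDiff_exp_eq zero_lt_one hxC hx0
  -- the explicit logarithm `F(t) = Log (1 + t (w − 1))` has the same derivative on `[0,1]`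
  set F : ℝ → ℂ := fun t => log (1 + (t : ℂ) * (w - 1)) with hF_def
  have hFd : ∀ t ∈ Icc (0 : ℝ) 1, HasDerivAt F ((w - 1) / (1 + (t : ℂ) * (w - 1))) t := by
    intro t ht
    have h1 : HasDerivAt (fun s : ℝ => 1 + (s : ℂ) * (w - 1)) (w - 1) t := by
      have h := ((hasDerivAt_id (t : ℂ)).mul_const (w - 1)).const_add 1
      simpa using h.comp_ofReal
    exact h1.clog_real (hslit_t t ht)
  have hderiv_x : ∀ t ∈ Icc (0 : ℝ) 1, derivWithin x (Icc 0 1) t = q - p := fun t ht =>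
    (hxd t).hasDerivWithinAt.derivWithin (uniqueDiffOn_Icc zero_lt_one t ht)
  have hLd' : ∀ t ∈ Icc (0 : ℝ) 1, HasDerivAt L ((w - 1) / (1 + (t : ℂ) * (w - 1))) t := by
    intro t ht
    have h := hLd t ht
    rw [hderiv_x t ht] at h
    have e : (q - p) / x t = (w - 1) / (1 + (t : ℂ) * (w - 1)) := by
      rw [hxw, ← hw]
      have h1 : (1 + (t : ℂ) * (w - 1)) ≠ 0 := slitPlane_ne_zero (hslit_t t ht)
      field_simp
    rwa [e] at h
  -- `L − F` is constant on `[0,1]`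
  have hD : ∀ t ∈ Icc (0 : ℝ) 1, HasDerivWithinAt (fun s => L s - F s) 0 (Icc 0 1) t := by
    intro t ht
    have h := ((hLd' t ht).sub (hFd t ht)).hasDerivWithinAt (s := Icc 0 1)
    rwa [sub_self] at h
  have hconst := constant_of_derivWithin_zero
    (fun t ht => (hD t ht).differentiableWithinAt)
    (fun t ht => (hD t (Ico_subset_Icc_self ht)).derivWithin
      (uniqueDiffOn_Icc zero_lt_one t (Ico_subset_Icc_self ht)))
  have h1 : L 1 - F 1 = L 0 - F 0 := hconst 1 ⟨zero_le_one, le_rfl⟩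
  have hF0 : F 0 = 0 := by simp [F]
  have hF1 : F 1 = log w := by simp [F]
  refine ⟨L, hLC, fun t ht => hLexp t ht, ?_, ?_⟩
  · rw [hLexp 0 ⟨le_rfl, zero_le_one⟩]; simp [x]
  · rw [hF0, hF1] at h1
    linear_combination h1

/-- **A segment symbol on `𝔾ₘ` is a logarithm symbol.** If the first coordinate of `γ` runs along
the segment from `p` to `q = w p` (`p ∈ ℚ̄*`, `w ∉ (−∞,0]`), then `(𝔾ₘ, y dx, γ) ∼ ℓ(Log w)` modulo
the `ℚ̄`-span of the elementary relations ((R5) to the exponential path, then (R4) base change).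
[cite: HuberWustholz2022, §3.3.1 (pp. 42–43), §13.1 (B) (p. 120)] -/
theorem span_segment_logSym {p q w : ℂ} (hp : IsAlgebraic ℚ p) (hp0 : p ≠ 0) (hw : w * p = q)
    (hslit : w ∈ slitPlane) (γ : CurvePath 𝔾m)
    (hγ : ∀ t ∈ Icc (0 : ℝ) 1, γ.toFun t 0 = p + t * (q - p))
    (E : CurvePath 𝔾m)
    (hE : ∀ t, E.toFun t = ![exp ((1 - t) * 0 + t * log w), exp (-((1 - t) * 0 + t * log w))]) :
    InSpanRel (Finsupp.single (logSym γ) (1 : ℂ) - Finsupp.single (logSym E) 1) := by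
  obtain ⟨L, hLC, hLexp, hL0, hL1⟩ := exists_log_segment hp0 hw hslit
  have hLx : ∀ t ∈ Icc (0 : ℝ) 1, exp (L t) = γ.toFun t 0 := fun t ht => by
    rw [hLexp t ht, hγ t ht]
  obtain ⟨E₁, ρ₁, ρ₂, ρ₃, ρ₄, hE₁, h₁, h₂, h₃, h₄, he⟩ :=
    single_path_eq_single_expPath ![X 1, 0] hasAlgCoeffs_ydx γ L hLC hLx
  have halg : IsAlgebraic ℚ (exp (L 0)) := by rw [hL0]; exact hp
  have hE' : ∀ t, E.toFun t =
      ![exp ((1 - t) * 0 + t * (L 1 - L 0)), exp (-((1 - t) * 0 + t * (L 1 - L 0)))] := by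
    intro t; rw [hE, hL1]
  have hbc := rel_expPath_baseChange halg E₁ E hE₁ hE'
  obtain ⟨k, ρ, a, hρ, ha, hsum⟩ := span_add (span_add (span_sub (span_add (span_of_rel h₃)
    (span_of_rel h₄)) (span_of_rel h₁)) (span_smul isAlgebraic_one.neg (span_of_rel h₂)))
    (span_of_rel hbc)
  refine ⟨k, ρ, a, hρ, ha, ?_⟩
  rw [← hsum, he]
  simp only [neg_one_smul]
  abel

end Summit.KontsevichZagierPeriods.KzOnePeriods.G0Derivation

end
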